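import Literature.NumberTheory.Transcendental.BKModelStages
import Literature.NumberTheory.Transcendental.GammaFieldRegularity
import Literature.NumberTheory.Transcendental.ZilberFieldGSGC
import Literature.NumberTheory.Transcendental.ExpVarieties
import Mathlib.RingTheory.AlgebraicIndependent.Adjoin
import Mathlib.RingTheory.AlgebraicIndependent.TranscendenceBasis
import Mathlib.FieldTheory.IsAlgClosed.Basic
import HarnessLib

/-!
# The countable model over a partial exponential field, II: generic points and the
exponential-algebraic-closedness step

M. Bays, J. Kirby, *Pseudo-exponential maps, variants, and quasiminimality*, Algebra & Number
Theory 12 (2018), Thm 5.9 with Lemma 8.3 (⟸): the countable model realises, over every finitely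
generated strong stage, generic points of the rotund free varieties (the extensions `B` of `A`
generated by `b` with `Loc(b/A) = V`, "By Prop. 7.3 the extension is strong. Since `V` is free …
`δ(b/A) = 0`"). Inside the fixed algebraically closed field `Ω` this is: for the Γ-field `L` of a
stage (algebraically closed, of finite transcendence degree inside `Ω`) and a prime ideal `P` of
`L[X]`, there is a generic point of `P` in `Ω` (`BKModel.exists_genericPt`: embed the function
field `Frac(L[X]/P)` into `Ω` over `L` through fresh transcendentals and `IsAlgClosed.lift`), and
adjoining its coordinates with their prescribed exponentials is a strong kernel-preserving
extension of the stage when the point is *admissible* (`BKModel.State.exists_step_point`).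

## References

* M. Bays, J. Kirby, *Pseudo-exponential maps, variants, and quasiminimality*, Algebra & Number
  Theory 12 (2018) 493–549: Prop. 7.3, Lemma 8.3, Thm 5.9.
-/

noncomputable section

open Set MvPolynomial

namespace Literature.NumberTheory.Transcendental

namespace BKModel

open GammaField Literature.ModelTheory.ExponentialFields Literature.FieldTheory.AlgClosed

/-! ### Embedding finitely generated fields along a transcendence basis -/

section Embed

variable {L F Ω : Type*} [Field L] [Field F] [Field Ω] [Algebra L F] [Algebra L Ω] [IsAlgClosed Ω]

/-- **Embedding a field extension with a finite transcendence basis into an algebraically closed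
field with enough transcendentals**: if `s : ι₀ → F` is a transcendence basis of `F/L` and
`w : ι₀ → Ω` is algebraically independent over `L`, there is an `L`-algebra homomorphism `F → Ω`.
[folklore] -/
theorem exists_algHom_of_isTranscendenceBasis {ι₀ : Type*} {s : ι₀ → F} (hs : IsTranscendenceBasis L s)
    {w : ι₀ → Ω} (hw : AlgebraicIndependent L w) : Nonempty (F →ₐ[L] Ω) := by
  -- the subfield `L(s)` and its isomorphism with the rational function field
  set K₁ := IntermediateField.adjoin L (range s) with hK₁
  haveI : Algebra.IsAlgebraic K₁ F := hs.isAlgebraic_field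
  let e₁ : FractionRing (MvPolynomial ι₀ L) ≃ₐ[L] K₁ := hs.1.aevalEquivField
  let φ : FractionRing (MvPolynomial ι₀ L) →ₐ[L] Ω :=
    IsFractionRing.liftAlgHom (algebraicIndependent_iff_injective_aeval.1 hw)
  let φ₁ : K₁ →ₐ[L] Ω := φ.comp e₁.symm.toAlgHom
  letI : Algebra K₁ Ω := φ₁.toRingHom.toAlgebra
  haveI : IsScalarTower L K₁ Ω := IsScalarTower.of_algebraMap_eq fun x => by
    change algebraMap L Ω x = φ₁ (algebraMap L K₁ x)
    rw [AlgHom.commutes]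
  let ψ : F →ₐ[K₁] Ω := IsAlgClosed.lift
  exact ⟨ψ.restrictScalars L⟩

end Embed

/-! ### Generic points of prime ideals over the Γ-field of a stage -/

section GenericPt

variable {Ω : Type*} [Field Ω] [CharZero Ω] [IsAlgClosed Ω]

omit [IsAlgClosed Ω] in
/-- Sequentially fresh tuples: `k` elements each transcendental over `C` and the previous ones.
[folklore] -/
theorem exists_fresh_tuple {C : Set Ω} (fresh : ∀ T : Set Ω, T.Finite → ∃ w, w ∉ acl (C ∪ T)) :
    ∀ k : ℕ, ∃ u : Fin k → Ω, ∀ j : Fin k, u j ∉ acl (C ∪ u '' {i | i < j}) := by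
  intro k
  induction k with
  | zero => exact ⟨Fin.elim0, fun j => j.elim0⟩
  | succ k ih =>
    obtain ⟨u, hu⟩ := ih
    obtain ⟨w, hw⟩ := fresh (range u) (finite_range u)
    refine ⟨Fin.snoc u w, fun j => ?_⟩
    refine Fin.lastCases ?_ (fun j => ?_) j
    · rw [Fin.snoc_last]
      refine fun h => hw (acl_mono (union_subset_union_right C ?_) h)
      rintro _ ⟨i, hi, rfl⟩
      have hi' : (i : ℕ) < k := hi
      refine ⟨⟨i, hi'⟩, ?_⟩
      simp [Fin.snoc, hi', Fin.castLT]
    · rw [Fin.snoc_castSucc]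
      refine fun h => hu j (acl_mono (union_subset_union_right C ?_) h)
      rintro _ ⟨i, hi, rfl⟩
      have hij : (i : ℕ) < j := hi
      have hik : (i : ℕ) < k := lt_trans hij j.2
      refine ⟨⟨i, hik⟩, hij, ?_⟩
      simp [Fin.snoc, hik, Fin.castLT]

set_option synthInstance.maxHeartbeats 400000 in
set_option maxHeartbeats 1600000 in
/-- **Generic points over the Γ-field of a stage** (Bays–Kirby 2018, proof of Lemma 8.3 / Thm 5.9:
realising the extension generated by a generic point of `V`): for an intermediate field `L`
inside `acl C` over which `Ω` has transcendentals in every finite codimension, every prime ideal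
`P` of `L[X]` (finitely many variables) has a generic point in `Ω` — a point whose ideal over `L`
is exactly `P`. [cite: BaysKirby2018ANT, Lemma 8.3 (proof)] -/
theorem exists_genericPt (L : IntermediateField ℚ Ω) {C : Set Ω} (hLC : (L : Set Ω) ⊆ acl C)
    (fresh : ∀ T : Set Ω, T.Finite → ∃ w, w ∉ acl (C ∪ T))
    {ι' : Type*} [Finite ι'] (P : Ideal (MvPolynomial ι' L)) [hP : P.IsPrime] :
    ∃ z : ι' → Ω, ∀ p : MvPolynomial ι' L, aeval z p = 0 ↔ p ∈ P := by
  classical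
  haveI : IsDomain (MvPolynomial ι' L ⧸ P) := Ideal.Quotient.isDomain P
  haveI : FaithfulSMul L (MvPolynomial ι' L ⧸ P) :=
    (faithfulSMul_iff_algebraMap_injective L (MvPolynomial ι' L ⧸ P)).2
      (algebraMap L (MvPolynomial ι' L ⧸ P)).injective
  -- a transcendence basis of the coordinate ring, finite since the coordinate ring is of finite type
  obtain ⟨t, ht⟩ := exists_isTranscendenceBasis L (MvPolynomial ι' L ⧸ P)
  haveI : Algebra.FiniteType L (MvPolynomial ι' L ⧸ P) :=
    Algebra.FiniteType.of_surjective (Ideal.Quotient.mkₐ L P) (Ideal.Quotient.mkₐ_surjective L P)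
  have htfin : t.Finite := by
    have h1 := ht.cardinalMk_eq_trdeg
    have h2 : Algebra.trdeg L (MvPolynomial ι' L ⧸ P) < Cardinal.aleph0 := _root_.trdeg_lt_aleph0
    rw [← h1] at h2
    exact Cardinal.lt_aleph0_iff_set_finite.1 h2
  haveI : Algebra.IsAlgebraic (MvPolynomial ι' L ⧸ P) (FractionRing (MvPolynomial ι' L ⧸ P)) :=
    IsLocalization.isAlgebraic (FractionRing (MvPolynomial ι' L ⧸ P))
      (nonZeroDivisors (MvPolynomial ι' L ⧸ P))
  have ht' : IsTranscendenceBasis L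
      (algebraMap (MvPolynomial ι' L ⧸ P) (FractionRing (MvPolynomial ι' L ⧸ P)) ∘ ((↑) : t → _)) :=
    ht.algebraMap_comp
  -- fresh transcendentals indexed by `t`
  haveI := htfin.fintype
  obtain ⟨k, ⟨e⟩⟩ := Finite.exists_equiv_fin t
  obtain ⟨u, hu⟩ := exists_fresh_tuple fresh k
  have hu' : AlgebraicIndependent L u := algebraicIndependent_of_forall_not_mem_acl L hLC u hu
  have hw : AlgebraicIndependent L (u ∘ e) := hu'.comp _ e.injective
  -- the embedding
  obtain ⟨ψ⟩ := exists_algHom_of_isTranscendenceBasis ht' hw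
  let j : (MvPolynomial ι' L ⧸ P) →ₐ[L] FractionRing (MvPolynomial ι' L ⧸ P) :=
    IsScalarTower.toAlgHom L (MvPolynomial ι' L ⧸ P) (FractionRing (MvPolynomial ι' L ⧸ P))
  have hj : Function.Injective j := IsFractionRing.injective (MvPolynomial ι' L ⧸ P) _
  let Φ : MvPolynomial ι' L →ₐ[L] Ω := ψ.comp (j.comp (Ideal.Quotient.mkₐ L P))
  refine ⟨fun i => Φ (X i), fun p => ?_⟩
  have hcomp : (aeval fun i => Φ (X i)) = Φ := MvPolynomial.algHom_ext fun i => by rw [aeval_X]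
  rw [hcomp]
  change ψ (j (Ideal.Quotient.mk P p)) = 0 ↔ p ∈ P
  rw [map_eq_zero_iff ψ ψ.toRingHom.injective, map_eq_zero_iff j hj, Ideal.Quotient.eq_zero_iff_mem]

end GenericPt

/-! ### Adjoining an admissible point: the iterated extension -/

section Point

variable {Ω : Type*} [Field Ω] [CharZero Ω] [IsAlgClosed Ω]
variable {K : Type*} [Field K] [CharZero K] {ι : K →+* Ω} {D : Submodule ℚ K} {θ : K → K} {τ : K}

omit [CharZero Ω] [IsAlgClosed Ω] in
/-- `E` of a finite sum is the product of the values. [folklore] -/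
theorem EHom.map_sum (E : EHom Ω) {α : Type*} (s : Finset α) (f : α → Ω) :
    E (∑ a ∈ s, f a) = ∏ a ∈ s, E (f a) := by
  classical
  induction s using Finset.induction_on with
  | empty => simp [E.map_zero_eq_one]
  | insert a s has ih => rw [Finset.sum_insert has, Finset.prod_insert has, E.map_add_eq_mul, ih]

omit [CharZero Ω] [IsAlgClosed Ω] in
/-- `E (∑ⱼ Mⱼ xⱼ) = ∏ⱼ E(xⱼ)^{Mⱼ}` for integer coefficients. [folklore] -/
theorem EHom.map_sum_intCast_mul (E : EHom Ω) {n : ℕ} (m : Fin n → ℤ) (x : Fin n → Ω) :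
    E (∑ j, (m j : Ω) * x j) = ∏ j, E (x j) ^ m j := by
  rw [E.map_sum]
  refine Finset.prod_congr rfl fun j _ => ?_
  rw [← zsmul_eq_mul, E.map_zsmul_eq_zpow]

/-- The domain after adjoining the first `i` coordinates. [folklore] -/
def domUpTo (Λ : Submodule ℚ Ω) {n : ℕ} (x : Fin n → Ω) (i : ℕ) : Submodule ℚ Ω :=
  Λ ⊔ Submodule.span ℚ (x '' {j : Fin n | (j : ℕ) < i})

omit [IsAlgClosed Ω] in
/-- `domUpTo` at `i + 1` is `domUpTo` at `i` plus `ℚ xᵢ`. [folklore] -/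
theorem domUpTo_succ (Λ : Submodule ℚ Ω) {n : ℕ} (x : Fin n → Ω) {i : ℕ} (hi : i < n) :
    domUpTo Λ x (i + 1) = domUpTo Λ x i ⊔ Submodule.span ℚ {x ⟨i, hi⟩} := by
  rw [domUpTo, domUpTo, sup_assoc, ← Submodule.span_union]
  congr 2
  ext w
  simp only [mem_image, mem_setOf_eq, union_singleton, mem_insert_iff]
  constructor
  · rintro ⟨j, hj, rfl⟩
    rcases Nat.lt_succ_iff_lt_or_eq.1 hj with h | h
    · exact Or.inr ⟨j, h, rfl⟩
    · left; congr 1; exact Fin.ext h.symm |>.symm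
  · rintro (rfl | ⟨j, hj, rfl⟩)
    · exact ⟨⟨i, hi⟩, Nat.lt_succ_self i, rfl⟩
    · exact ⟨j, Nat.lt_succ_of_lt hj, rfl⟩

omit [IsAlgClosed Ω] in
/-- `domUpTo` at `n` is `Λ + ℚ x`. [folklore] -/
theorem domUpTo_self (Λ : Submodule ℚ Ω) {n : ℕ} (x : Fin n → Ω) :
    domUpTo Λ x n = Λ ⊔ Submodule.span ℚ (range x) := by
  rw [domUpTo]
  congr 2
  ext w
  simp only [mem_image, mem_setOf_eq, mem_range]
  exact ⟨fun ⟨j, _, h⟩ => ⟨j, h⟩, fun ⟨j, h⟩ => ⟨j, j.2, h⟩⟩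

omit [IsAlgClosed Ω] in
/-- `domUpTo` at `0` is `Λ`. [folklore] -/
theorem domUpTo_zero (Λ : Submodule ℚ Ω) {n : ℕ} (x : Fin n → Ω) : domUpTo Λ x 0 = Λ := by
  rw [domUpTo]
  have : x '' {j : Fin n | (j : ℕ) < 0} = ∅ := by
    rw [image_eq_empty]; ext j; simp
  rw [this, Submodule.span_empty, sup_bot_eq]

omit [IsAlgClosed Ω] in
/-- The next coordinate is not in the current domain when no rational combination of the
coordinates lies in a set containing the base domain. [folklore] -/
theorem notMem_domUpTo {Λ : Submodule ℚ Ω} {n : ℕ} {x : Fin n → Ω} {C : Set Ω} (hΛC : (Λ : Set Ω) ⊆ C)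
    (hx : ∀ q : Fin n → ℚ, (∑ j, q j • x j) ∈ C → q = 0) {i : ℕ} (hi : i < n) :
    x ⟨i, hi⟩ ∉ domUpTo Λ x i := by
  classical
  intro hmem
  obtain ⟨v, hv, w, hw, hvw⟩ := Submodule.mem_sup.1 hmem
  rw [Submodule.mem_span_image_iff_exists_fun] at hw
  obtain ⟨t, hts, c, hc⟩ := hw
  have hit : (⟨i, hi⟩ : Fin n) ∉ t := fun h => lt_irrefl i (hts h)
  -- the rational relation `∑_{j ∈ t} c_j x_j - x_i = -v ∈ Λ`
  let q : Fin n → ℚ := fun j => (if hj : j ∈ t then c ⟨j, hj⟩ else 0) + (if j = ⟨i, hi⟩ then -1 else 0)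
  have hsum : (∑ j, q j • x j) = w - x ⟨i, hi⟩ := by
    simp only [q, add_smul, Finset.sum_add_distrib, ite_smul, zero_smul, Finset.sum_ite_eq',
      Finset.mem_univ, if_true, neg_one_smul]
    rw [← hc, sub_eq_add_neg]
    congr 1
    rw [← Finset.sum_subset (Finset.subset_univ t) (fun j _ hj => by rw [dif_neg hj, zero_smul]),
      ← Finset.sum_coe_sort t]
    refine Finset.sum_congr rfl fun j _ => ?_
    rw [dif_pos j.2]
  have hq : q = 0 := hx q (by
    rw [hsum]
    have : w - x ⟨i, hi⟩ = -v := by rw [← hvw]; abel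
    rw [this]
    exact hΛC (Λ.neg_mem hv))
  have : q ⟨i, hi⟩ = -1 := by simp [q, hit]
  rw [hq] at this
  exact absurd this (by norm_num)

/-- **The iterated extension by the coordinates of a multiplicatively free point** (Kirby 2013
§2; Bays–Kirby 2018 §3.2 with Lemma 3.18, extensions with the same kernel): for `i ≤ n` there is
a homomorphism
extending `E` with `xⱼ ↦ yⱼ` (`j < i`) whose kernel on `Λ + ℚ x_{<i}` is still `ι(τ)ℤ`, because
every value on that domain is a radical of an element of `E(Λ) · ⟨y_{<i}⟩` and no non-trivial
monomial in `y` is algebraic over the Γ-field.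
[cite: BaysKirby2018ANT, §3.2 and Lemma 3.18] [cite: Kirby2013FPEF, §2] -/
theorem State.exists_iterate (σ : State ι D θ τ) {n : ℕ}
    {x y : Fin n → Ω} (hy : ∀ j, y j ≠ 0)
    (hxfree : ∀ q : Fin n → ℚ, (∑ j, q j • x j) ∈ acl (@GammaField.gens Ω _ _ σ.E.inst σ.Λ) → q = 0)
    (hyfree : ∀ m : Fin n → ℤ, (∏ j, y j ^ m j) ∈ acl (@GammaField.gens Ω _ _ σ.E.inst σ.Λ) → m = 0) :
    ∀ i : ℕ, i ≤ n → ∃ Ei : EHom Ω, (∀ v ∈ σ.Λ, Ei v = σ.E v) ∧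
      (∀ j : Fin n, (j : ℕ) < i → Ei (x j) = y j) ∧
      (∀ v ∈ domUpTo σ.Λ x i, Ei v = 1 → v ∈ AddSubgroup.zmultiples (ι τ)) ∧
      (∀ v ∈ domUpTo σ.Λ x i, ∃ d : ℕ, 0 < d ∧ ∃ μ ∈ σ.Λ, ∃ m : Fin n → ℤ,
        (∀ j : Fin n, i ≤ (j : ℕ) → m j = 0) ∧ Ei v ^ d = σ.E μ * ∏ j, y j ^ m j) := by
  classical
  have hΛC : (σ.Λ : Set Ω) ⊆ acl (@GammaField.gens Ω _ _ σ.E.inst σ.Λ) :=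
    fun v hv => subset_acl _ (@GammaField.mem_gens_of_mem Ω _ _ σ.E.inst _ _ hv)
  intro i
  induction i with
  | zero =>
    intro _
    refine ⟨σ.E, fun _ _ => rfl, fun j hj => absurd hj (Nat.not_lt_zero _), ?_, ?_⟩
    · intro v hv; rw [domUpTo_zero] at hv; exact (σ.ker v hv).1
    · intro v hv
      rw [domUpTo_zero] at hv
      exact ⟨1, one_pos, v, hv, 0, fun _ _ => rfl, by simp⟩
  | succ i ih =>
    intro hi
    have hi' : i < n := Nat.lt_of_succ_le hi
    obtain ⟨Ei, hEΛ, hEx, hker, hrad⟩ := ih hi'.le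
    set a := x ⟨i, hi'⟩ with ha
    have haΛ : a ∉ domUpTo σ.Λ x i := notMem_domUpTo hΛC hxfree hi'
    obtain ⟨E', ρ, h1, hadd, hne, hE', hform⟩ :=
      exists_hom_extend_single Ei.map_add_eq_mul (domUpTo σ.Λ x i) haΛ (hy ⟨i, hi'⟩)
    have hE'0 : E' 0 = 1 := by
      have := hform 0 (Submodule.zero_mem _) 0
      rw [zero_smul, add_zero, Ei.map_zero_eq_one, ratPow_zero hadd hne, mul_one] at this
      exact this
    let E₁ : EHom Ω := ⟨E', hE'0, hE'⟩
    have hE₁old : ∀ v ∈ domUpTo σ.Λ x i, E₁ v = Ei v := fun v hv => by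
      have := hform v hv 0
      rw [zero_smul, add_zero, ratPow_zero hadd hne, mul_one] at this
      exact this
    have hdec : ∀ v ∈ domUpTo σ.Λ x (i + 1), ∃ w ∈ domUpTo σ.Λ x i, ∃ q : ℚ, v = w + q • a := by
      intro v hv
      rw [domUpTo_succ σ.Λ x hi'] at hv
      obtain ⟨w, hw, u, hu, rfl⟩ := Submodule.mem_sup.1 hv
      obtain ⟨q, rfl⟩ := Submodule.mem_span_singleton.1 hu
      exact ⟨w, hw, q, rfl⟩
    refine ⟨E₁, fun v hv => ?_, fun j hj => ?_, fun v hv hv1 => ?_, fun v hv => ?_⟩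
    · -- on `Λ`
      rw [hE₁old v (by rw [domUpTo]; exact Submodule.mem_sup_left hv)]; exact hEΛ v hv
    · -- the coordinates
      rcases Nat.lt_succ_iff_lt_or_eq.1 hj with h | h
      · have hxj : x j ∈ domUpTo σ.Λ x i :=
          Submodule.mem_sup_right (Submodule.subset_span ⟨j, h, rfl⟩)
        rw [hE₁old _ hxj]; exact hEx j h
      · have hj' : j = ⟨i, hi'⟩ := Fin.ext h
        rw [hj', ← ha]
        have := hform 0 (Submodule.zero_mem _) 1
        rw [one_smul, zero_add, Ei.map_zero_eq_one, one_mul, h1] at this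
        exact this
    · -- the kernel
      obtain ⟨w, hw, q, rfl⟩ := hdec v hv
      obtain ⟨d, hd, μ, hμ, m, hm0, hrw⟩ := hrad w hw
      change E' (w + q • a) = 1 at hv1
      rw [hform w hw q] at hv1
      -- raise to the power `d * q.den`
      have hpow : (σ.E μ * ∏ j, y j ^ m j) ^ q.den * (y ⟨i, hi'⟩ ^ q.num) ^ d = 1 := by
        rw [← hrw, ← ratPow_pow_den h1 hadd hne q, ← pow_mul, ← pow_mul, mul_comm q.den d,
          ← mul_pow, hv1, one_pow]
      -- the monomial `∏ y^{m'}` with `m' = den • m + (d * num) eᵢ` is a value of `E` on `Λ`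
      set m' : Fin n → ℤ := fun j => (q.den : ℤ) * m j + if j = ⟨i, hi'⟩ then (d : ℤ) * q.num else 0
        with hm'
      have hprod : (∏ j, y j ^ m' j) = (∏ j, y j ^ m j) ^ q.den * (y ⟨i, hi'⟩ ^ q.num) ^ d := by
        rw [← Finset.prod_pow]
        have : (y ⟨i, hi'⟩ ^ q.num) ^ d = ∏ j, y j ^ (if j = ⟨i, hi'⟩ then (d : ℤ) * q.num else 0) := by
          rw [Finset.prod_eq_single (⟨i, hi'⟩ : Fin n)]
          · simp only [if_true]; rw [← zpow_natCast, ← zpow_mul, mul_comm]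
          · intro j _ hj; simp [hj]
          · intro h; exact absurd (Finset.mem_univ _) h
        rw [this, ← Finset.prod_mul_distrib]
        refine Finset.prod_congr rfl fun j _ => ?_
        rw [hm', zpow_add₀ (hy j), ← zpow_natCast, ← zpow_mul, mul_comm (m j)]
      have hval : (∏ j, y j ^ m' j) = σ.E (-(q.den • μ)) := by
        rw [hprod, σ.E.map_neg_eq_inv, σ.E.map_nsmul_eq_pow]
        apply eq_inv_of_mul_eq_one_left
        calc (∏ j, y j ^ m j) ^ q.den * (y ⟨i, hi'⟩ ^ q.num) ^ d * σ.E μ ^ q.den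
            = (σ.E μ * ∏ j, y j ^ m j) ^ q.den * (y ⟨i, hi'⟩ ^ q.num) ^ d := by rw [mul_pow]; ring
          _ = 1 := hpow
      have hm'0 : m' = 0 := hyfree m' (by
        rw [hval]
        exact subset_acl _ (@GammaField.exp_mem_gens Ω _ _ σ.E.inst _ _ (σ.Λ.neg_mem
          (σ.Λ.toAddSubgroup.nsmul_mem hμ _))))
      have hq : q = 0 := by
        have := congrFun hm'0 ⟨i, hi'⟩
        simp only [hm', hm0 ⟨i, hi'⟩ le_rfl, mul_zero, zero_add, if_true, Pi.zero_apply,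
          mul_eq_zero, Int.natCast_eq_zero, Rat.num_eq_zero] at this
        rcases this with h | h
        · exact absurd h hd.ne'
        · exact h
      rw [hq, zero_smul, add_zero]
      rw [hq, ratPow_zero hadd hne, mul_one] at hv1
      exact hker w hw hv1
    · -- radicals
      obtain ⟨w, hw, q, rfl⟩ := hdec v hv
      obtain ⟨d, hd, μ, hμ, m, hm0, hrw⟩ := hrad w hw
      refine ⟨d * q.den, Nat.mul_pos hd q.den_pos, q.den • μ, σ.Λ.toAddSubgroup.nsmul_mem hμ _,
        fun j => (q.den : ℤ) * m j + if j = ⟨i, hi'⟩ then (d : ℤ) * q.num else 0, fun j hj => ?_, ?_⟩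
      · have hji : j ≠ ⟨i, hi'⟩ := fun h => by rw [h] at hj; exact Nat.not_succ_le_self i hj
        simp [hji, hm0 j (Nat.le_of_succ_le hj)]
      · change E' (w + q • a) ^ (d * q.den) = _
        rw [hform w hw q, mul_pow, pow_mul, hrw, mul_comm d q.den, pow_mul,
          ratPow_pow_den h1 hadd hne q, σ.E.map_nsmul_eq_pow, mul_pow, ← Finset.prod_pow]
        have : (y ⟨i, hi'⟩ ^ q.num) ^ d = ∏ j, y j ^ (if j = ⟨i, hi'⟩ then (d : ℤ) * q.num else 0) := by
          rw [Finset.prod_eq_single (⟨i, hi'⟩ : Fin n)]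
          · simp only [if_true]; rw [← zpow_natCast, ← zpow_mul, mul_comm]
          · intro j _ hj; simp [hj]
          · intro h; exact absurd (Finset.mem_univ _) h
        rw [this, mul_assoc, ← Finset.prod_mul_distrib]
        congr 1
        refine Finset.prod_congr rfl fun j _ => ?_
        rw [zpow_add₀ (hy j), ← zpow_natCast, ← zpow_mul, mul_comm (m j)]

omit [IsAlgClosed Ω] in
/-- `ldim_X(Λ + S) = ldim_X(S)` for `Λ ≤ X`. [folklore] -/
theorem ldim_sup_of_le {Λ X : Submodule ℚ Ω} (h : Λ ≤ X) (S : Submodule ℚ Ω) :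
    ldim X (Λ ⊔ S) = ldim X S := by
  rw [← ldim_sup_left X (Λ ⊔ S), ← sup_assoc, sup_of_le_left h, ldim_sup_left]

omit [IsAlgClosed Ω] in
/-- For `x` with no rational relation in a set containing `Λ`, `ldim(ℚx/Λ) = n`. [folklore] -/
theorem ldim_span_eq_of_free {Λ : Submodule ℚ Ω} {n : ℕ} {x : Fin n → Ω} {C : Set Ω}
    (hΛC : (Λ : Set Ω) ⊆ C) (hx : ∀ q : Fin n → ℚ, (∑ j, q j • x j) ∈ C → q = 0) :
    ldim Λ (Submodule.span ℚ (range x)) = n := by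
  have hli : LinearIndependent ℚ (Λ.mkQ ∘ x) := by
    rw [Fintype.linearIndependent_iff]
    intro q hq j
    have : (∑ i, q i • (Λ.mkQ ∘ x) i) = Λ.mkQ (∑ i, q i • x i) := by simp [map_sum, map_smul]
    rw [this, Submodule.mkQ_apply, Submodule.Quotient.mk_eq_zero] at hq
    exact congrFun (hx q (hΛC hq)) j
  rw [ldim, Submodule.map_span, ← range_comp, finrank_span_eq_card hli, Fintype.card_fin]

/-- **Adjoining an admissible point is a strong kernel-preserving extension** (Bays–Kirby 2018,
Lemma 8.3 (⟸) with Prop. 7.3: for `b` generic in a rotund, additively and multiplicatively free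
`V` over `A`, the extension of `A` generated by `b` is strong and kernel-preserving). Here the
point `(x, y)` over the stage `σ` is *admissible*: `yⱼ ≠ 0`, no rational combination of `x` and no
monomial in `y` is algebraic over the Γ-field of `σ` (freeness for a generic point), and
`rk M ≤ td([M](x, y)/Γ-field)` for every integer matrix `M` (rotundity for a generic point).
[cite: BaysKirby2018ANT, Lemma 8.3 and Prop. 7.3] -/
theorem State.exists_step_point (hK : IsStdKernelPartialExpField K D θ τ) (σ : State ι D θ τ)
    {n : ℕ} {x y : Fin n → Ω} (hy : ∀ j, y j ≠ 0)
    (hxfree : ∀ q : Fin n → ℚ, (∑ j, q j • x j) ∈ acl (@GammaField.gens Ω _ _ σ.E.inst σ.Λ) → q = 0)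
    (hyfree : ∀ m : Fin n → ℤ, (∏ j, y j ^ m j) ∈ acl (@GammaField.gens Ω _ _ σ.E.inst σ.Λ) → m = 0)
    (hrot : ∀ M : Matrix (Fin n) (Fin n) ℤ, ((M.map (Int.cast : ℤ → ℚ)).rank : ℕ∞) ≤
      (algMatroid Ω).relRank (acl (@GammaField.gens Ω _ _ σ.E.inst σ.Λ))
        (range (matrixAct M (Sum.elim x y)))) :
    ∃ σ' : State ι D θ τ, Step σ σ' ∧ σ'.Λ = σ.Λ ⊔ Submodule.span ℚ (range x) ∧
      ∀ j, σ'.E (x j) = y j := by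
  classical
  have hΛC : (σ.Λ : Set Ω) ⊆ acl (@GammaField.gens Ω _ _ σ.E.inst σ.Λ) :=
    fun v hv => subset_acl _ (@GammaField.mem_gens_of_mem Ω _ _ σ.E.inst _ _ hv)
  obtain ⟨E', hEΛ, hEx, hker, -⟩ := σ.exists_iterate hy hxfree hyfree n le_rfl
  rw [domUpTo_self] at hker
  let σ' : State ι D θ τ :=
    { Λ := σ.Λ ⊔ Submodule.span ℚ (range x)
      E := E'
      base_le := σ.base_le.trans le_sup_left
      base_exp := fun v hv => by
        rw [hEΛ _ (σ.base_le (mem_baseSub_iff.2 ⟨v, hv, rfl⟩))]; exact σ.base_exp v hv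
      ker := fun v hv => ⟨hker v hv, fun h => by
        have hmem : v ∈ σ.Λ := σ.zmultiples_subset hK h
        rw [hEΛ v hmem]; exact (σ.ker v hmem).2 h⟩
      fg := σ.fg.sup (isFG_span_of_finite _ (finite_range x)) }
  refine ⟨σ', ⟨le_sup_left, hEΛ, ?_⟩, rfl, fun j => hEx j j.2⟩
  -- strongness from rotundity
  intro X hΛX hX hfg
  letI := E'.inst
  change 0 ≤ predim σ.Λ X
  have hgensΛ : gens σ.Λ = @GammaField.gens Ω _ _ σ.E.inst σ.Λ := gens_congr hEΛ
  obtain ⟨s, M, hrank, hrows, hsN⟩ := ZilberGSGC.exists_relation_matrix X x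
  -- `ldim(X/Λ) = s`
  have hfgΛ' : IsFG σ.Λ (σ.Λ ⊔ Submodule.span ℚ (range x)) :=
    isFG_sup_left.2 (isFG_span_of_finite _ (finite_range x))
  have hn : ldim σ.Λ (σ.Λ ⊔ Submodule.span ℚ (range x)) = n := by
    rw [ldim_sup_left]; exact ldim_span_eq_of_free hΛC hxfree
  have hadd := ldim_add hΛX hX hfgΛ'
  rw [hn, ldim_sup_of_le hΛX] at hadd
  have hldim : ldim σ.Λ X = s := by omega
  -- `td(X/Λ) ≥ s`
  have hsub : range (matrixAct M (Sum.elim x y)) ⊆ gens X := by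
    rintro _ ⟨k, rfl⟩
    rcases k with k | k
    · rw [matrixAct_inl]
      exact mem_gens_of_mem (by simpa using hrows k)
    · rw [matrixAct_inr]
      have : (∏ j, Sum.elim x y (Sum.inr j) ^ M k j) = E' (∑ j, (M k j : Ω) * x j) := by
        rw [E'.map_sum_intCast_mul]
        exact Finset.prod_congr rfl fun j _ => by rw [Sum.elim_inr, hEx j j.2]
      rw [this]
      exact exp_mem_gens (hrows k)
  have htd : (s : ℕ∞) ≤ td σ.Λ X := by
    rw [td_def, hgensΛ, ← (algMatroid Ω).relRank_closure_left]
    calc (s : ℕ∞) = ((M.map (Int.cast : ℤ → ℚ)).rank : ℕ∞) := by rw [hrank]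
      _ ≤ _ := hrot M
      _ ≤ _ := (algMatroid Ω).relRank_mono_right _ hsub
  have hfin : td σ.Λ X ≠ ⊤ := td_ne_top hfg
  have htd' : s ≤ (td σ.Λ X).toNat := by
    rw [← ENat.coe_toNat hfin] at htd
    exact_mod_cast htd
  rw [predim_def, hldim]
  omega

end Point

end BKModel

end Literature.NumberTheory.Transcendental
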